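import Mathlib
import HarnessLib
import Summits.BirchSwinnertonDyer.BirchSwinnertonDyer.Theses.ManinLocalTwoThree
import Summits.BirchSwinnertonDyer.BirchSwinnertonDyer.Theorems.ManinLocalTwoThreeKummerDiamondIndexFourShapeNoCES
import Summits.BirchSwinnertonDyer.BirchSwinnertonDyer.Theorems.ManinLocalTwoThreeStevensCuspInvGaloisAction
import Literature.NumberTheory.Automorphic.UnboundedDenominators

/-!
# Lines/kummer_diamond.lean — v8 (width seat p2 gen 24, 2026-08-30T10:0xZ; = v7 with `stub_Tes75` DISCHARGED): C2 `ManinOddAtFour` ⟸ ONE PRINTED FACT {CDT}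

v8 = v7 with the stub `stub_Tes75` (T-es-75, Stevens 1982 Thm 1.3.1 (b)) replaced by the LEAD's THEOREM
`ManinLocalTwoThree.StevensGalois.optimalGamma1Parametrization_cuspInv_galoisAction_holds` (p766724, `…StevensCuspInvGaloisAction.lean`, proved
analytically from the Galois action on `q_N`-expansions of `SL₂(ℤ)`-translates).  ONE stub remains: `stub_CDT` (Calegari–Dimitrov–Tang 2025 Thm 1,
statement-only, not formalisable in the tree: arithmetic holonomy bounds / Nevanlinna theory; LEAD-MEMO v43 §2).  The closer of record with the same
content is `Theorems.maninLocalTwoThree_maninOddAtFour_of_CDT` (p766825).  v7 header kept below for the record.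

## v7 header (p2 gen 22)

v6 (LEAD p1 gen 20, 0de8f1e73b85) had stubs {stub_CDT, stub_CES, stub_Tes75}; LEAD g20 closed out at 06:03Z, so the width seat registers v7 (same line, same composition idea; candidate copy: `Lines/kummer_diamond_noCES_candidate.lean`).  The stub `stub_CES`
(`exists_optimal_gamma1ParametrizationData`, Conrad–Edixhoven–Stein 2003) is NOT needed: in E-es-185♭'s world (`|c₀| = 2`, `Λ₁(f) = 2Λ₀(f)`)
the `X₀(N)`-optimal curve `W₀` ITSELF carries an optimal `X₁(N)`-datum (p2 gen 22 `FlatGamma1Datum.exists_flat_gamma1ParametrizationData`,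
p763227: `Λ_{W₀} = c₀Λ₀ = (c₀/2)·Λ₁`, degree field from a `Γ₁(N)` twin of `exists_modularDegree_holds`), so THEOREM K♮ (es `kummerDiamondReciprocity`,
⟸ T-es-75) applies to it directly (`KummerDiamondIndexFourNoCES.indexFour_kummerDiamondReciprocity_of_even`, p763417) and the LEAD's flat assembly runs
with THEOREM K's conclusion as its only input (`two_pow_five_dvd_and_hasFreyTwistShape_of_kummerValues`, fact-free).

* `stub_CDT`   — Calegari–Dimitrov–Tang 2025 Thm 1.0.1 (unbounded denominators), statement-only;
* `stub_Tes75` — T-es-75 `optimalGamma1Parametrization_cuspInv_galoisAction` (Stevens 1982 Thm 1.3.1(b)), statement-only.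

COMPOSITION (no sorry): `KummerDiamondIndexFourNoCES.maninOddAtFour_of_CDT_Tes75 stub_CDT stub_Tes75` (p763417) =
`CDivTranslate.maninOddAtFour_of_CDTInt_shape185Flat stub_CDT (KummerDiamondIndexFourNoCES.shape185Flat_of_Tes75 stub_Tes75)`.

HONEST FRAMING: C2 is proved CONDITIONALLY on two named, printed, statement-only Literature facts; the item `ManinOddAtFour`
(stmt-BirchSwinnertonDyer-22967) does NOT close by name unless the planner adds these binders (ROUTE EDIT 3, now {CDT, T-es-75}) or the facts are
discharged.  Whole route: `KummerDiamondIndexFourNoCES.maninConstantOne_of_sixPrintedFacts` (Mazur 78, Abbes–Ullmo 96, Česnavičius 18, modularity,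
CDT 25, Stevens 82 (b)).  BSD is not proved; Manin's conjecture is not proved.
-/

set_option autoImplicit false
set_option linter.dupNamespace false

noncomputable section

open Literature.NumberTheory.EllipticCurves.ModularForms

namespace Summit.BirchSwinnertonDyer.BirchSwinnertonDyer.Cruxes.ManinOddAtFour.KummerDiamondLine

/-- STUB (PRINTED) CDT Theorem 1.0.1 (`CalegariDimitrovTang2025_unboundedDenominators`); CITE-ONLY. -/
theorem stub_CDT : Literature.NumberTheory.Automorphic.CalegariDimitrovTang2025_unboundedDenominators := by
  sorry

/-- FORMER STUB T-es-75 — Stevens 1982 Thm 1.3.1(b) (Galois action on the cusps `[1;y]` of `X₁(N)`): now a THEOREM of the tree (LEAD p1 gen 22,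
p766724 `StevensGalois.optimalGamma1Parametrization_cuspInv_galoisAction_holds`); kept under its stub name so the composition is byte-identical. -/
theorem stub_Tes75 : optimalGamma1Parametrization_cuspInv_galoisAction :=
  Summit.BirchSwinnertonDyer.BirchSwinnertonDyer.Theorems.ManinLocalTwoThree.StevensGalois.optimalGamma1Parametrization_cuspInv_galoisAction_holds

/-- COMPOSITION (no sorry): p2 gen 22 `KummerDiamondIndexFourNoCES.maninOddAtFour_of_CDT_Tes75` (E-es-185♭ ⟸ T-es-75 by the flat `X₁(N)`-datum
and the kummer_diamond assembly; C2 ⟸ CDT ∧ E-es-185♭ by p3's flat composition with p2's E-es-186♭). -/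
theorem ManinOddAtFour_of :
    Summit.BirchSwinnertonDyer.BirchSwinnertonDyer.Theses.ManinLocalTwoThree.ManinOddAtFour :=
  Summit.BirchSwinnertonDyer.BirchSwinnertonDyer.Theorems.ManinLocalTwoThree.KummerDiamondIndexFourNoCES.maninOddAtFour_of_CDT_Tes75
    stub_CDT stub_Tes75

end Summit.BirchSwinnertonDyer.BirchSwinnertonDyer.Cruxes.ManinOddAtFour.KummerDiamondLine

end
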